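import Mathlib
import Summits.Ventures.HodgeRepro.Tier4.Common.AdelicDefs
import Summits.Ventures.HodgeRepro.Tier4.Common.AdelicRTF
import Summits.Ventures.HodgeRepro.Tier4.Line1.PlaneDefs
import Summits.Ventures.HodgeRepro.Tier4.Line1.SigmaCompactGA
import Summits.Ventures.HodgeRepro.Tier4.Line1.TorusCocompact

/-!
# Tier4/Line1/RTFDataOfCharacters — LINE L1, (I0-R): the RTF datum from its characters

Blind re-derivation cell `pub-hodge-repro`, Tier 4 (README §9–§10), seat t4-L1-p4 (g2), LINE L1, rung (I0-R) of the
costume `line1_realise` (t4-plan-1 g1, S13293).  typer-2's `RTFData W` (Common/AdelicRTF.lean) bundles the two toric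
characters with their seven clauses AND the torus measures / fundamental domains.  This module separates the two halves:
the SEVEN CHARACTER CLAUSES stay DISPLAYED (`chi`, `chi'`, multiplicativity, triviality on the rational points, and
`hcentre` — N2, the hidden hypothesis of the line named in Skeleton v0.27's scope clause — nothing is claimed about
the characters' existence), and the MEASURE / DOMAIN HALF IS PROVED:

* `torusHaar W` / `torusHaar' W` — Mathlib's `Measure.haar` on the tori, Haar by `torusHaar_isHaarMeasure` (t4-L1-p5's
  `locallyCompact_torusT` / `locallyCompact_torusT'`, SigmaCompactGA p665016);
* `exists_torusDomain` / `exists_torusDomain'` — a fundamental domain of the rational points with compact closure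
  (t4-L1-p5's (I1-c′) / (I1-c″) `torus_quotient_compact_of_genuine` / `torus'_quotient_compact_of_genuine`,
  TorusCocompact p674404, consumed BY NAME);
* `RTFData.ofCharacters W hW hg chi chi' hmul hmul' hrat hrat' hcentre : RTFData W` — the datum, with
  `ofCharacters_μT_isHaarMeasure`, `ofCharacters_μT'_isHaarMeasure`, `ofCharacters_hT`, `ofCharacters_hT'` = the four
  instance / compactness facts the skeleton's `RTFDatum` (Skeleton-v0.32 L971–L994) and `exists_rtfDatum_defined`
  (L1102) consume, and the bundled `exists_rtfData_of_characters`.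

Measurability: the σ-algebras on the tori are the subtype σ-algebras of `[MeasurableSpace (GA W)] [BorelSpace (GA W)]`,
exactly as in the skeleton.  No printed input.

Nothing here says anything about the status of the Hodge conjecture for CM abelian varieties, which is NOT proved
(HC_CM is NOT proved by anyone in this repository).
-/

set_option autoImplicit false

noncomputable section

namespace Summit.Ventures.HodgeRepro.Tier4.Line1

open MeasureTheory Summit.Ventures.HodgeRepro.Tier4.Common

section OfCharacters

variable {k : Type} [Field k] [NumberField k] (W : PlaneData k) [MeasurableSpace (GA W)] [BorelSpace (GA W)]

/-- **The Haar measure on `T(𝔸_k)`** (Mathlib's `Measure.haar`; `T` is locally compact by t4-L1-p5's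
`locallyCompact_torusT`). -/
def torusHaar : Measure (torusT W) :=
  haveI := locallyCompact_torusT W
  Measure.haar

/-- **The Haar measure on `T′(𝔸_k)`.** -/
def torusHaar' : Measure (torusT' W) :=
  haveI := locallyCompact_torusT' W
  Measure.haar

/-- `torusHaar W` is a Haar measure. -/
theorem torusHaar_isHaarMeasure : (torusHaar W).IsHaarMeasure := by
  haveI := locallyCompact_torusT W
  unfold torusHaar
  infer_instance

/-- `torusHaar' W` is a Haar measure. -/
theorem torusHaar'_isHaarMeasure : (torusHaar' W).IsHaarMeasure := by
  haveI := locallyCompact_torusT' W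
  unfold torusHaar'
  infer_instance

/-- **A fundamental domain of `T(k)` in `T(𝔸_k)` with compact closure, for the Haar measure `torusHaar W`**
(t4-L1-p5's (I1-c′) `torus_quotient_compact_of_genuine`, by name). -/
theorem exists_torusDomain (hW : IsDefinite W) (hg : IsGenuineRow W) :
    ∃ D : Set (torusT W), IsFundamentalDomain (rationalOf W (torusT W)) D (torusHaar W) ∧
      IsCompact (closure D) := by
  haveI := torusHaar_isHaarMeasure W
  exact torus_quotient_compact_of_genuine W hW hg (torusHaar W)

/-- **A fundamental domain of `T′(k)` in `T′(𝔸_k)` with compact closure** ((I1-c″), by name). -/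
theorem exists_torusDomain' (hW : IsDefinite W) (hg : IsGenuineRow W) :
    ∃ D : Set (torusT' W), IsFundamentalDomain (rationalOf W (torusT' W)) D (torusHaar' W) ∧
      IsCompact (closure D) := by
  haveI := torusHaar'_isHaarMeasure W
  exact torus'_quotient_compact_of_genuine W hW hg (torusHaar' W)

/-- **THE RTF DATUM FROM ITS CHARACTERS** ((I0-R)): the seven character clauses are the DISPLAYED inputs (`hcentre` is
N2 — kept displayed), the torus measures are `torusHaar W` / `torusHaar' W` and the fundamental domains are the ones of
`exists_torusDomain` / `exists_torusDomain'` (t4-L1-p5's TorusCocompact by name). -/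
def RTFData.ofCharacters (hW : IsDefinite W) (hg : IsGenuineRow W)
    (chi : torusT W → ℂ) (chi' : torusT' W → ℂ)
    (hmul : ∀ s t : torusT W, chi (s * t) = chi s * chi t)
    (hmul' : ∀ s t : torusT' W, chi' (s * t) = chi' s * chi' t)
    (hrat : ∀ t : torusT W, (t : GA W) ∈ rationalPoints W → chi t = 1)
    (hrat' : ∀ t : torusT' W, (t : GA W) ∈ rationalPoints W → chi' t = 1)
    (hcentre : ∀ (z : GA W) (hz : z ∈ centre W),
      chi ⟨z, centre_le_torusT W hz⟩ = chi' ⟨z, centre_le_torusT' W hz⟩) : RTFData W where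
  chi := chi
  chi' := chi'
  chi_mul := hmul
  chi'_mul := hmul'
  chi_rational := hrat
  chi'_rational := hrat'
  chi_centre := hcentre
  μT := torusHaar W
  μT' := torusHaar' W
  DT := Classical.choose (exists_torusDomain W hW hg)
  DT' := Classical.choose (exists_torusDomain' W hW hg)
  DT_fund := (Classical.choose_spec (exists_torusDomain W hW hg)).1
  DT'_fund := (Classical.choose_spec (exists_torusDomain' W hW hg)).1

variable (hW : IsDefinite W) (hg : IsGenuineRow W)
  (chi : torusT W → ℂ) (chi' : torusT' W → ℂ)
  (hmul : ∀ s t : torusT W, chi (s * t) = chi s * chi t)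
  (hmul' : ∀ s t : torusT' W, chi' (s * t) = chi' s * chi' t)
  (hrat : ∀ t : torusT W, (t : GA W) ∈ rationalPoints W → chi t = 1)
  (hrat' : ∀ t : torusT' W, (t : GA W) ∈ rationalPoints W → chi' t = 1)
  (hcentre : ∀ (z : GA W) (hz : z ∈ centre W),
    chi ⟨z, centre_le_torusT W hz⟩ = chi' ⟨z, centre_le_torusT' W hz⟩)

/-- the characters of the datum are the given ones. -/
theorem ofCharacters_chi : (RTFData.ofCharacters W hW hg chi chi' hmul hmul' hrat hrat' hcentre).chi = chi := rfl

/-- the second character of the datum is the given one. -/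
theorem ofCharacters_chi' :
    (RTFData.ofCharacters W hW hg chi chi' hmul hmul' hrat hrat' hcentre).chi' = chi' := rfl

/-- the torus measure of the datum is a Haar measure (the `[haarT]` field of the skeleton's `RTFDatum`). -/
theorem ofCharacters_μT_isHaarMeasure :
    (RTFData.ofCharacters W hW hg chi chi' hmul hmul' hrat hrat' hcentre).μT.IsHaarMeasure :=
  torusHaar_isHaarMeasure W

/-- the second torus measure of the datum is a Haar measure (the `[haarT']` field). -/
theorem ofCharacters_μT'_isHaarMeasure :
    (RTFData.ofCharacters W hW hg chi chi' hmul hmul' hrat hrat' hcentre).μT'.IsHaarMeasure :=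
  torusHaar'_isHaarMeasure W

/-- the torus domain of the datum is relatively compact (the `hT` field of the skeleton's `RTFDatum`). -/
theorem ofCharacters_hT :
    IsCompact (closure (RTFData.ofCharacters W hW hg chi chi' hmul hmul' hrat hrat' hcentre).DT) :=
  (Classical.choose_spec (exists_torusDomain W hW hg)).2

/-- the second torus domain of the datum is relatively compact (the `hT'` field). -/
theorem ofCharacters_hT' :
    IsCompact (closure (RTFData.ofCharacters W hW hg chi chi' hmul hmul' hrat hrat' hcentre).DT') :=
  (Classical.choose_spec (exists_torusDomain' W hW hg)).2

include hW hg hmul hmul' hrat hrat' hcentre in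
/-- **Bundled form**: an `RTFData` with the given characters, Haar torus measures and relatively compact domains
exists — the shape of plan-4's R2 ask (`exists_rtfData_isHaar`, S12373), with the seven character clauses displayed. -/
theorem exists_rtfData_of_characters :
    ∃ R : RTFData W, R.chi = chi ∧ R.chi' = chi' ∧ R.μT.IsHaarMeasure ∧ R.μT'.IsHaarMeasure ∧
      IsCompact (closure R.DT) ∧ IsCompact (closure R.DT') :=
  ⟨RTFData.ofCharacters W hW hg chi chi' hmul hmul' hrat hrat' hcentre, rfl, rfl,
    ofCharacters_μT_isHaarMeasure W hW hg chi chi' hmul hmul' hrat hrat' hcentre,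
    ofCharacters_μT'_isHaarMeasure W hW hg chi chi' hmul hmul' hrat hrat' hcentre,
    ofCharacters_hT W hW hg chi chi' hmul hmul' hrat hrat' hcentre,
    ofCharacters_hT' W hW hg chi chi' hmul hmul' hrat hrat' hcentre⟩

end OfCharacters

end Summit.Ventures.HodgeRepro.Tier4.Line1

end
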